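import Mathlib
import Summits.AnomalousDissipation.AnomalousDissipation.Theses.CoherentStates
import Summits.AnomalousDissipation.AnomalousDissipation.Theses.Neg
import Literature.Analysis.FunctionSpaces.TorusFluidGlueProofs

/-!
# `SteadyNegTameOffThinSets` from the thin-set Liouville lemma (stmt-AnomalousDissipation-1049)

Route `AnomalousDissipation/CoherentStates` (support item, rank 9; the same declaration is item
#9 of route `Neg`). The item is `SteadyNeg` (stmt-0222) restricted to vanishing-viscosity families
of steady classical Navier–Stokes solutions `u_j` (fixed smooth force `f`, `∫‖u_j‖² ≤ E`) that
converge pointwise off a closed set `S` of upper Minkowski codimension `≥ 2` to a pair `(U, P)`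
which is `C¹` off `S` and solves steady Euler there. Conclusion: `ν_j ‖∇u_j‖₂² → 0`.

This file proves the GLUE announced in the item text: the thin-set Liouville lemma
`Neg.SteadyThinSetLiouville` (stmt-AnomalousDissipation-1047: `∫⟪f, U⟫ = 0` for such `(U, P, S)`
with `U ∈ L²`) implies the item, for both route copies of the declaration. Steps:

1. steady energy identity `ν_j ‖∇u_j‖₂² = ∫⟪f, u_j⟫` (`steady_energy_identity`, from the proved
   fact `Torus.IsClassicalNSSolutionOn.energy_balance_holds`: the kinetic energy of a
   time-constant solution is constant, so its derivative `-ν‖∇u‖² + ∫⟪f,u⟫` vanishes);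
2. `volume S = 0` (`measure_eq_zero_of_thickening_le`: `S ⊆ S_ρ`, `volume S_ρ ≤ Cρ² → 0`), so
   `u_j → U` almost everywhere;
3. Fatou: an a.e. limit of fields with `∫‖u_j‖² ≤ K` is in `L²` with `∫‖U‖² ≤ K`
   (`memLp_two_of_tendsto_ae`);
4. Vitali by hand (`tendsto_integral_of_tendsto_ae_of_sq_le`): real functions `g_j → G` a.e. with
   `∫ g_j² ≤ K` on a finite measure space have `∫ g_j → ∫ G` (truncation
   `|w| ≤ min(|w|, M) + w²/M`, dominated convergence for the truncated part);
5. with `g_j = ⟪f, u_j⟫`, `G = ⟪f, U⟫` (`|g_j|² ≤ ‖f‖∞² ‖u_j‖²`), `∫⟪f, u_j⟫ → ∫⟪f, U⟫ = 0` by the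
   Liouville lemma (`f` smooth ⇒ continuous).

Sources: Doering–Foias, JFM 467 (2002) §2 and Foias–Manley–Rosa–Temam (2001) p.101 (12.39)
(steady energy identity); the measure theory is folklore (Fatou, Vitali).
-/

set_option linter.dupNamespace false  -- `Summit.AnomalousDissipation.AnomalousDissipation` is the mandated summit/problem namespace

noncomputable section

open MeasureTheory Filter Topology Set
open scoped InnerProductSpace ENNReal
open Literature.Analysis.FunctionSpaces

namespace Summit.AnomalousDissipation.AnomalousDissipation.Theorems.CoherentStates

/-! ## Step 1: the steady energy identity -/

/-- **Steady energy identity.** For a steady classical solution of the forced Navier–Stokes system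
on `T^d` (written as a time-constant `IsClassicalNSSolutionOn univ`), `ν ‖∇u‖₂² = ∫ ⟪f, u⟫`:
the kinetic energy `t ↦ E(u)` is constant, and by the energy balance its derivative is
`-ν ‖∇u‖₂² + ∫ ⟪f, u⟫` (Doering–Foias 2002 §2 (2.4); FMRT 2001 p.101 (12.39)). [folklore] -/
theorem steady_energy_identity {d : Type*} [Fintype d] [DecidableEq d] {ν : ℝ}
    {f u : UnitAddTorus d → EuclideanSpace ℝ d} {p : UnitAddTorus d → ℝ}
    (h : Torus.IsClassicalNSSolutionOn Set.univ ν (fun _ => f) (fun _ => u) (fun _ => p)) :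
    ν * Torus.gradNormSq u = ∫ x, ⟪f x, u x⟫_ℝ := by
  have hd := Torus.IsClassicalNSSolutionOn.energy_balance_holds h convex_univ (Set.mem_univ (0 : ℝ))
  rw [hasDerivWithinAt_univ] at hd
  have h0 : HasDerivAt (fun _ : ℝ => Torus.kineticEnergy u) (0 : ℝ) (0 : ℝ) := hasDerivAt_const _ _
  have := h0.unique hd
  linarith

/-! ## Step 2: thin sets are null -/

/-- A set whose `ρ`-thickenings have measure `≤ C ρ²` for all `ρ > 0` is a null set
(`S ⊆ S_ρ` and `C ρ² → 0`). [folklore] -/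
theorem measure_eq_zero_of_thickening_le {X : Type*} [PseudoEMetricSpace X] [MeasurableSpace X]
    (μ : Measure X) {S : Set X} {C : ℝ}
    (hS : ∀ ρ : ℝ, 0 < ρ → μ (Metric.thickening ρ S) ≤ ENNReal.ofReal (C * ρ ^ 2)) :
    μ S = 0 := by
  refine le_antisymm ?_ bot_le
  have ht : Tendsto (fun ρ : ℝ => ENNReal.ofReal (C * ρ ^ 2)) (𝓝[>] (0 : ℝ)) (𝓝 0) := by
    have h1 : Tendsto (fun ρ : ℝ => C * ρ ^ 2) (𝓝 (0 : ℝ)) (𝓝 (C * 0 ^ 2)) :=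
      ((continuous_const.mul (continuous_pow 2)).tendsto 0)
    have h2 : Tendsto (fun ρ : ℝ => C * ρ ^ 2) (𝓝 (0 : ℝ)) (𝓝 0) := by simpa using h1
    have h3 := ENNReal.tendsto_ofReal h2
    rw [ENNReal.ofReal_zero] at h3
    exact h3.mono_left nhdsWithin_le_nhds
  refine ge_of_tendsto ht ?_
  filter_upwards [self_mem_nhdsWithin] with ρ hρ
  exact (measure_mono (Metric.self_subset_thickening hρ S)).trans (hS ρ hρ)

/-! ## Step 3: Fatou — a.e. limits of `L²`-bounded sequences -/

section MeasureTheory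

variable {α : Type*} [MeasurableSpace α] {μ : Measure α}

/-- **Fatou in `L²`.** If `v n → V` a.e. and `∫ ‖v n‖² ≤ K` for all `n` (with `‖v n‖²`
integrable), then `V ∈ L²` and `∫ ‖V‖² ≤ K`. [folklore] -/
theorem memLp_two_of_tendsto_ae {E : Type*} [NormedAddCommGroup E] {v : ℕ → α → E} {V : α → E}
    {K : ℝ} (hv : ∀ n, AEStronglyMeasurable (v n) μ)
    (hint : ∀ n, Integrable (fun x => ‖v n x‖ ^ 2) μ) (hK : ∀ n, ∫ x, ‖v n x‖ ^ 2 ∂μ ≤ K)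
    (hlim : ∀ᵐ x ∂μ, Tendsto (fun n => v n x) atTop (𝓝 (V x))) :
    MemLp V 2 μ ∧ ∫ x, ‖V x‖ ^ 2 ∂μ ≤ K := by
  have hVm : AEStronglyMeasurable V μ := aestronglyMeasurable_of_tendsto_ae atTop hv hlim
  have hK0 : 0 ≤ K := (integral_nonneg fun x => sq_nonneg _).trans (hK 0)
  -- Fatou on `ofReal ‖v n‖²`
  have hF : ∫⁻ x, ENNReal.ofReal (‖V x‖ ^ 2) ∂μ ≤ ENNReal.ofReal K := by
    have hae : ∀ᵐ x ∂μ, liminf (fun n => ENNReal.ofReal (‖v n x‖ ^ 2)) atTop =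
        ENNReal.ofReal (‖V x‖ ^ 2) := by
      filter_upwards [hlim] with x hx
      exact (ENNReal.tendsto_ofReal ((hx.norm).pow 2)).liminf_eq
    calc ∫⁻ x, ENNReal.ofReal (‖V x‖ ^ 2) ∂μ
        = ∫⁻ x, liminf (fun n => ENNReal.ofReal (‖v n x‖ ^ 2)) atTop ∂μ :=
          lintegral_congr_ae (hae.mono fun x hx => hx.symm)
      _ ≤ liminf (fun n => ∫⁻ x, ENNReal.ofReal (‖v n x‖ ^ 2) ∂μ) atTop :=
          lintegral_liminf_le' fun n => ((hv n).norm.aemeasurable.pow_const 2).ennreal_ofReal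
      _ ≤ ENNReal.ofReal K := by
          refine liminf_le_of_frequently_le' (Frequently.of_forall fun n => ?_)
          rw [← ofReal_integral_eq_lintegral_ofReal (hint n) (ae_of_all _ fun x => sq_nonneg _)]
          exact ENNReal.ofReal_le_ofReal (hK n)
  have hVint : Integrable (fun x => ‖V x‖ ^ 2) μ := by
    refine ⟨(hVm.norm.pow 2), ?_⟩
    rw [hasFiniteIntegral_iff_ofReal (ae_of_all _ fun x => sq_nonneg _)]
    exact hF.trans_lt ENNReal.ofReal_lt_top
  refine ⟨(memLp_two_iff_integrable_sq_norm hVm).2 hVint, ?_⟩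
  rw [← ENNReal.ofReal_le_ofReal_iff hK0,
    ofReal_integral_eq_lintegral_ofReal hVint (ae_of_all _ fun x => sq_nonneg _)]
  exact hF

/-! ## Step 4: Vitali by truncation -/

/-- Truncation inequality: for `t, M` real with `M > 0`, `|t| ≤ min |t| M + t² / M`. [folklore] -/
theorem abs_le_min_add_sq_div (t : ℝ) {M : ℝ} (hM : 0 < M) : |t| ≤ min |t| M + t ^ 2 / M := by
  rcases le_or_gt |t| M with h | h
  · rw [min_eq_left h]
    have : 0 ≤ t ^ 2 / M := div_nonneg (sq_nonneg _) hM.le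
    linarith
  · rw [min_eq_right h.le]
    have h1 : |t| ≤ t ^ 2 / M := by
      rw [le_div_iff₀ hM, ← sq_abs, sq]
      exact mul_le_mul_of_nonneg_left h.le (abs_nonneg _)
    linarith [hM.le]

/-- **Vitali (bounded second moments).** On a finite measure space, if real functions `g n → G`
a.e. and `∫ (g n)² ≤ K` for all `n`, then `∫ g n → ∫ G` (the family is uniformly integrable;
proof by truncation at height `M` and dominated convergence). [folklore] -/
theorem tendsto_integral_of_tendsto_ae_of_sq_le [IsFiniteMeasure μ] {g : ℕ → α → ℝ} {G : α → ℝ}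
    {K : ℝ} (hg : ∀ n, AEStronglyMeasurable (g n) μ)
    (hg2 : ∀ n, Integrable (fun x => g n x ^ 2) μ) (hK : ∀ n, ∫ x, g n x ^ 2 ∂μ ≤ K)
    (hlim : ∀ᵐ x ∂μ, Tendsto (fun n => g n x) atTop (𝓝 (G x))) :
    Tendsto (fun n => ∫ x, g n x ∂μ) atTop (𝓝 (∫ x, G x ∂μ)) := by
  have hK0 : 0 ≤ K := (integral_nonneg fun x => sq_nonneg _).trans (hK 0)
  -- Fatou: `G ∈ L²`, `∫ G² ≤ K`
  have hnorm : ∀ (h : α → ℝ), (fun x => ‖h x‖ ^ 2) = fun x => h x ^ 2 := fun h => by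
    funext x; rw [Real.norm_eq_abs, sq_abs]
  obtain ⟨hGmem, hGK⟩ : MemLp G 2 μ ∧ ∫ x, ‖G x‖ ^ 2 ∂μ ≤ K :=
    memLp_two_of_tendsto_ae hg (fun n => by rw [hnorm]; exact hg2 n)
      (fun n => by rw [hnorm]; exact hK n) hlim
  rw [hnorm] at hGK
  have hGm : AEStronglyMeasurable G μ := hGmem.1
  have hG2 : Integrable (fun x => G x ^ 2) μ := hGmem.integrable_sq
  have hgmem : ∀ n, MemLp (g n) 2 μ := fun n => (memLp_two_iff_integrable_sq (hg n)).2 (hg2 n)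
  have hgi : ∀ n, Integrable (g n) μ := fun n => (hgmem n).integrable one_le_two
  have hGi : Integrable G μ := hGmem.integrable one_le_two
  -- the differences `w n = g n - G`
  set w : ℕ → α → ℝ := fun n x => g n x - G x with hw
  have hwm : ∀ n, AEStronglyMeasurable (w n) μ := fun n => (hg n).sub hGm
  have hwi : ∀ n, Integrable (w n) μ := fun n => (hgi n).sub hGi
  have hw2 : ∀ n, Integrable (fun x => w n x ^ 2) μ := fun n => ((hgmem n).sub hGmem).integrable_sq
  have hw2K : ∀ n, ∫ x, w n x ^ 2 ∂μ ≤ 4 * K := by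
    intro n
    have hpt : ∀ x, w n x ^ 2 ≤ 2 * g n x ^ 2 + 2 * G x ^ 2 := fun x => by
      simp only [hw]
      nlinarith [sq_nonneg (g n x + G x)]
    calc ∫ x, w n x ^ 2 ∂μ ≤ ∫ x, (2 * g n x ^ 2 + 2 * G x ^ 2) ∂μ :=
          integral_mono (hw2 n) (((hg2 n).const_mul 2).add (hG2.const_mul 2)) hpt
      _ = 2 * ∫ x, g n x ^ 2 ∂μ + 2 * ∫ x, G x ^ 2 ∂μ := by
          rw [integral_add ((hg2 n).const_mul 2) (hG2.const_mul 2), integral_const_mul,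
            integral_const_mul]
      _ ≤ 4 * K := by nlinarith [hK n, hGK]
  have hwlim : ∀ᵐ x ∂μ, Tendsto (fun n => w n x) atTop (𝓝 0) := by
    filter_upwards [hlim] with x hx
    simpa [hw] using hx.sub_const (G x)
  -- dominated convergence for the truncations
  have hmin : ∀ M : ℝ, 0 < M →
      Tendsto (fun n => ∫ x, min |w n x| M ∂μ) atTop (𝓝 0) := by
    intro M hM
    have hcont : Continuous fun t : ℝ => min |t| M := continuous_abs.min continuous_const
    have h := tendsto_integral_of_dominated_convergence (μ := μ) (fun _ => M)
      (F := fun n x => min |w n x| M) (f := fun _ => 0)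
      (fun n => hcont.comp_aestronglyMeasurable (hwm n)) (integrable_const M)
      (fun n => ae_of_all _ fun x => by
        rw [Real.norm_eq_abs, abs_of_nonneg (le_min (abs_nonneg _) hM.le)]
        exact min_le_right _ _)
      (by
        filter_upwards [hwlim] with x hx
        have := (hcont.tendsto 0).comp hx
        simpa [Function.comp_def, min_eq_left hM.le] using this)
    simpa using h
  -- ε-argument
  rw [Metric.tendsto_atTop]
  intro ε hε
  set M : ℝ := 8 * K / ε + 1 with hM
  have hMpos : 0 < M := by positivity
  have hKM : 4 * K / M ≤ ε / 2 := by
    rw [div_le_iff₀ hMpos, hM]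
    field_simp
    nlinarith
  obtain ⟨N, hN⟩ := (Metric.tendsto_atTop.1 (hmin M hMpos)) (ε / 2) (half_pos hε)
  refine ⟨N, fun n hn => ?_⟩
  have h1 : ∫ x, min |w n x| M ∂μ < ε / 2 := by
    have := hN n hn
    rw [Real.dist_0_eq_abs] at this
    exact (le_abs_self _).trans_lt this
  have hmini : Integrable (fun x => min |w n x| M) μ :=
    (integrable_const M).mono' ((continuous_abs.min continuous_const).comp_aestronglyMeasurable
      (hwm n)) (ae_of_all _ fun x => by
        rw [Real.norm_eq_abs, abs_of_nonneg (le_min (abs_nonneg _) hMpos.le)]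
        exact min_le_right _ _)
  have h2 : ∫ x, |w n x| ∂μ ≤ ∫ x, min |w n x| M ∂μ + (∫ x, w n x ^ 2 ∂μ) / M := by
    calc ∫ x, |w n x| ∂μ ≤ ∫ x, (min |w n x| M + w n x ^ 2 / M) ∂μ :=
          integral_mono (hwi n).abs (hmini.add ((hw2 n).div_const M))
            fun x => abs_le_min_add_sq_div (w n x) hMpos
      _ = ∫ x, min |w n x| M ∂μ + (∫ x, w n x ^ 2 ∂μ) / M := by
          rw [integral_add hmini ((hw2 n).div_const M), integral_div]
  have h3 : (∫ x, w n x ^ 2 ∂μ) / M ≤ ε / 2 :=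
    (div_le_div_of_nonneg_right (hw2K n) hMpos.le).trans hKM
  rw [Real.dist_eq, ← integral_sub (hgi n) hGi]
  calc |∫ x, (g n x - G x) ∂μ| ≤ ∫ x, |g n x - G x| ∂μ := abs_integral_le_integral_abs
    _ = ∫ x, |w n x| ∂μ := rfl
    _ < ε := by linarith

end MeasureTheory

/-! ## Step 5: the glue -/

/-- **Glue for stmt-AnomalousDissipation-1049.** The thin-set Liouville lemma
(`Neg.SteadyThinSetLiouville`, stmt-AnomalousDissipation-1047) implies `SteadyNegTameOffThinSets`
(route CoherentStates copy): by the steady energy identity `ν_j‖∇u_j‖² = ∫⟪f,u_j⟫`; the thin set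
`S` is null so `u_j → U` a.e.; `⟪f,u_j⟫ → ⟪f,U⟫` a.e. with `∫⟪f,u_j⟫² ≤ ‖f‖∞² E`, hence
`∫⟪f,u_j⟫ → ∫⟪f,U⟫` (Vitali) and `U ∈ L²` (Fatou); and `∫⟪f,U⟫ = 0` by the Liouville lemma.
[folklore] -/
theorem steadyNegTameOffThinSets_of_thinSetLiouville
    (hL : Summit.AnomalousDissipation.AnomalousDissipation.Theses.Neg.SteadyThinSetLiouville) :
    Summit.AnomalousDissipation.AnomalousDissipation.Theses.CoherentStates.SteadyNegTameOffThinSets := by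
  intro f hf _hfdiv _hfmean ν u p _hν _hν0 hsol hE U P S hS hthin hU hP hEuler hdivU hconv
  obtain ⟨E, hE⟩ := hE
  obtain ⟨C, hC⟩ := hthin
  -- smoothness and bounds
  have hfc : Continuous f := hf.continuous
  have hus : ∀ j, Torus.IsSmooth (u j) := fun j =>
    (hsol j).smooth_velocity.isSmooth_slice (Set.mem_univ (0 : ℝ))
  obtain ⟨Cf, hCf⟩ : ∃ Cf : ℝ, ∀ x, ‖f x‖ ≤ Cf := by
    obtain ⟨Cf, hCf⟩ := isCompact_univ.exists_bound_of_continuousOn (hfc.continuousOn (s := univ))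
    exact ⟨Cf, fun x => hCf x (Set.mem_univ x)⟩
  have hCf0 : 0 ≤ Cf := (norm_nonneg _).trans (hCf 0)
  -- Step 1: energy identity
  have hid : ∀ j, ν j * Torus.gradNormSq (u j) = ∫ x, ⟪f x, u j x⟫_ℝ := fun j =>
    steady_energy_identity (hsol j)
  simp_rw [hid]
  -- Step 2: a.e. convergence
  have hS0 : volume S = 0 := measure_eq_zero_of_thickening_le volume hC
  have hae : ∀ᵐ x ∂volume, Tendsto (fun j => u j x) atTop (𝓝 (U x)) := by
    filter_upwards [measure_eq_zero_iff_ae_notMem.1 hS0] with x hx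
    exact hconv x hx
  -- measurability / integrability of the `u j`
  have hum : ∀ j, AEStronglyMeasurable (u j) volume := fun j =>
    (hus j).continuous.integrable_unitAddTorus.aestronglyMeasurable
  have hu2 : ∀ j, Integrable (fun x => ‖u j x‖ ^ 2) volume := fun j =>
    ((hus j).continuous.norm.pow 2).integrable_unitAddTorus
  -- Step 3: `U ∈ L²`
  have hUmem : MemLp U 2 volume := (memLp_two_of_tendsto_ae hum hu2 hE hae).1
  -- Step 5 (target): `∫⟪f, U⟫ = 0`
  have hL0 : ∫ x, ⟪f x, U x⟫_ℝ = 0 := hL f U P S hS ⟨C, hC⟩ hfc hUmem hU hP hEuler hdivU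
  rw [← hL0]
  -- Step 4: Vitali for `g j = ⟪f, u j⟫`
  refine tendsto_integral_of_tendsto_ae_of_sq_le (K := Cf ^ 2 * E)
    (fun j => (hfc.inner (hus j).continuous).integrable_unitAddTorus.aestronglyMeasurable)
    (fun j => ((hfc.inner (hus j).continuous).pow 2).integrable_unitAddTorus)
    (fun j => ?_) ?_
  · calc ∫ x, ⟪f x, u j x⟫_ℝ ^ 2 ≤ ∫ x, Cf ^ 2 * ‖u j x‖ ^ 2 :=
          integral_mono ((hfc.inner (hus j).continuous).pow 2).integrable_unitAddTorus
            ((hu2 j).const_mul _) fun x => by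
              have h1 : |⟪f x, u j x⟫_ℝ| ≤ ‖f x‖ * ‖u j x‖ := abs_real_inner_le_norm _ _
              have h2 : ‖f x‖ * ‖u j x‖ ≤ Cf * ‖u j x‖ :=
                mul_le_mul_of_nonneg_right (hCf x) (norm_nonneg _)
              calc ⟪f x, u j x⟫_ℝ ^ 2 = |⟪f x, u j x⟫_ℝ| ^ 2 := (sq_abs _).symm
                _ ≤ (Cf * ‖u j x‖) ^ 2 := by
                    gcongr
                    exact h1.trans h2
                _ = Cf ^ 2 * ‖u j x‖ ^ 2 := by ring
      _ = Cf ^ 2 * ∫ x, ‖u j x‖ ^ 2 := integral_const_mul _ _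
      _ ≤ Cf ^ 2 * E := mul_le_mul_of_nonneg_left (hE j) (sq_nonneg _)
  · filter_upwards [hae] with x hx
    exact (tendsto_const_nhds (x := f x)).inner hx

/-- The same glue for the route-`Neg` copy of the declaration (identical statement).
[folklore] -/
theorem neg_steadyNegTameOffThinSets_of_thinSetLiouville
    (hL : Summit.AnomalousDissipation.AnomalousDissipation.Theses.Neg.SteadyThinSetLiouville) :
    Summit.AnomalousDissipation.AnomalousDissipation.Theses.Neg.SteadyNegTameOffThinSets :=
  steadyNegTameOffThinSets_of_thinSetLiouville hL

end Summit.AnomalousDissipation.AnomalousDissipation.Theorems.CoherentStates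

end
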